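import Summits.SmoothPoincare4.SmoothPoincare4.Theses.EntropyRung
import HarnessLib

/-!
# The cap piece floor (stub `helper_capPieceFloor`, P2, line `fat-conical-core-avr-logsobolev`,
crux `EntropyRung.SubcylindricalExistence`, item stmt-SmoothPoincare4-10871)

Let `g` be a Riemannian metric (Levi-Civita) on a closed smooth `4`-manifold `M` of the summit
binder, `Φ > 0` smooth, `R_G` continuous, `A > 0`, and `S ⊆ M` a region on which `R_G = 12/A²`
(the exactly round region of the cap).

Claim: if the cap-side round floor holds for the weight `Φ` with the CONSTANT potential `12/A²`
(for every `τ > 0` and every smooth `w` living in `S` with `∫ (4πτ)⁻² w² Φ⁴ dV_g = 1`,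
`log 6 − 2 ≤ ∫ (τ (12/A² · w² + 4 Φ⁻² |∇w|²_g) − w² log w² − 4 w²) (4πτ)⁻² Φ⁴ dV_g`), then the same
clause holds with the potential `R_G` in place of `12/A²`.

Proof (pure plumbing): apply the hypothesis at `τ := σ`, `w := v`; the two integrands agree
pointwise, since at a point where `v x = 0` both potential terms vanish and at a point where
`v x ≠ 0` we have `x ∈ S`, hence `R_G x = 12/A²`. No integrability is needed
(`MeasureTheory.integral_congr_ae` with an everywhere-true filter statement).

References: G. Perelman, *The entropy formula for the Ricci flow and its geometric applications*
(2002), §3.1 [Perelman2002Entropy].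
-/

noncomputable section

open scoped Manifold ContDiff Topology ENNReal NNReal RealInnerProductSpace
open Set Filter Function MeasureTheory
open Literature.Geometry.Lorentzian Literature.Geometry.Riemannian

-- the registered namespace `Summit.SmoothPoincare4.SmoothPoincare4.Theorems` repeats a component
set_option linter.dupNamespace false

namespace Summit.SmoothPoincare4.SmoothPoincare4.Theorems

/-- P2: **cap piece floor**. If `R_G = 12/A²` wherever the test function lives (the exactly round
region of `helper_capFloor`), the cap-side RoundBound for the weight `Φ` with potential `12/A²`
(hypothesis, the conclusion shape of `helper_capFloor`) is the weighted clause with potential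
`R_G` at level `log 6 − 2`. -/
theorem helper_capPieceFloor :
    ∀ (M : Type) [TopologicalSpace M] [T2Space M] [SecondCountableTopology M]
      [ChartedSpace (EuclideanSpace ℝ (Fin 4)) M] [IsManifold (𝓡 4) ∞ M] [CompactSpace M]
      [T3Space M] [MeasurableSpace M] [BorelSpace M]
      (g : PseudoRiemannianMetric (𝓡 4) ∞ (EuclideanSpace ℝ (Fin 4)) (TangentSpace (𝓡 4) : M → Type _))
      [g.HasLeviCivita] (hg : g.IsRiemannian) (Φ rG : M → ℝ) (A : ℝ) (S : Set M),
      ContMDiff (𝓡 4) 𝓘(ℝ, ℝ) ∞ Φ → (∀ x, 0 < Φ x) → Continuous rG → 0 < A →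
      (∀ x ∈ S, rG x = 12 / A ^ 2) →
      (∀ τ : ℝ, 0 < τ → ∀ w : M → ℝ, ContMDiff (𝓡 4) 𝓘(ℝ, ℝ) ∞ w → (∀ x, w x ≠ 0 → x ∈ S) →
        ∫ x, (4 * Real.pi * τ) ^ (-(4 : ℝ) / 2) * (w x) ^ 2 * (Φ x) ^ 4
            ∂(riemannianMeasure (g.toContMDiffRiemannianMetric hg)) = 1 →
          Real.log 6 - 2 ≤
            ∫ x, (τ * (12 / A ^ 2 * (w x) ^ 2 + 4 * ((Φ x)⁻¹ ^ 2 * g.gradSq w x))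
                - (w x) ^ 2 * Real.log ((w x) ^ 2) - 4 * (w x) ^ 2)
                * ((4 * Real.pi * τ) ^ (-(4 : ℝ) / 2) * (Φ x) ^ 4)
              ∂(riemannianMeasure (g.toContMDiffRiemannianMetric hg))) →
      ∀ σ : ℝ, 0 < σ → ∀ v : M → ℝ, ContMDiff (𝓡 4) 𝓘(ℝ, ℝ) ∞ v → (∀ x, v x ≠ 0 → x ∈ S) →
        ∫ x, (4 * Real.pi * σ) ^ (-(4 : ℝ) / 2) * (v x) ^ 2 * (Φ x) ^ 4
            ∂(riemannianMeasure (g.toContMDiffRiemannianMetric hg)) = 1 →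
          Real.log 6 - 2 ≤ ∫ x, (σ * (rG x * (v x) ^ 2 + 4 * ((Φ x)⁻¹ ^ 2 * g.gradSq v x))
              - (v x) ^ 2 * Real.log ((v x) ^ 2) - 4 * (v x) ^ 2)
              * ((4 * Real.pi * σ) ^ (-(4 : ℝ) / 2) * (Φ x) ^ 4)
            ∂(riemannianMeasure (g.toContMDiffRiemannianMetric hg)) := by
  intro M _ _ _ _ _ _ _ _ _ g _ hg Φ rG A S _hΦ _hΦpos _hrG _hA hS hcap σ hσ v hv hsupp hnorm
  refine (hcap σ hσ v hv hsupp hnorm).trans_eq (integral_congr_ae (ae_of_all _ fun x ↦ ?_))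
  dsimp only
  by_cases hvx : v x = 0
  · simp [hvx]
  · rw [hS x (hsupp x hvx)]

end Summit.SmoothPoincare4.SmoothPoincare4.Theorems

end
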